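import Mathlib
import HarnessLib
import Summits.AtomisticToContinuum.HydrodynamicLimit.Theses.MourreKoopmanCharges
import Summits.AtomisticToContinuum.HydrodynamicLimit.Theorems.MourreKoopmanChargesConservedVectorsOneBodyCesaro
import Summits.AtomisticToContinuum.HydrodynamicLimit.Theorems.MourreKoopmanChargesOneBodyCompletenessTorusMoments
import Summits.AtomisticToContinuum.HydrodynamicLimit.Theorems.MourreKoopmanChargesOneBodyCompletenessWindowPassage
import Summits.AtomisticToContinuum.HydrodynamicLimit.Theorems.MourreKoopmanChargesIdealGasNoDecay
import Summits.AtomisticToContinuum.HydrodynamicLimit.Theorems.MourreKoopmanChargesOneBodyCompletenessGibbsOrthogonality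
import Summits.AtomisticToContinuum.HydrodynamicLimit.Theorems.MourreKoopmanChargesOneBodyCompletenessReduction
import Summits.AtomisticToContinuum.HydrodynamicLimit.Theorems.MourreKoopmanChargesOneBodyCompletenessSplit
import Summits.AtomisticToContinuum.HydrodynamicLimit.Theorems.MourreKoopmanChargesStressStrongMixingStressFramework
import Summits.AtomisticToContinuum.HydrodynamicLimit.Theorems.MourreKoopmanChargesStressStrongMixingObservableSpan
import Summits.AtomisticToContinuum.HydrodynamicLimit.Theorems.MourreKoopmanChargesStressStrongMixingFoelnerPositivity
import Summits.AtomisticToContinuum.HydrodynamicLimit.Theorems.MourreKoopmanChargesStressStrongMixingGibbsMoments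
import Summits.AtomisticToContinuum.HydrodynamicLimit.Theorems.MourreKoopmanChargesStressStrongMixingEquilibriumFlowShiftCovariant
import Summits.AtomisticToContinuum.HydrodynamicLimit.Theorems.MourreKoopmanChargesOneBodyCompletenessDiluteGibbsStateUnit
import Summits.AtomisticToContinuum.HydrodynamicLimit.Theorems.MourreKoopmanChargesOneBodyCompletenessDensityClustering
import Summits.AtomisticToContinuum.HydrodynamicLimit.Theorems.MourreKoopmanChargesOneBodyCompletenessChargeClustering
import Summits.AtomisticToContinuum.HydrodynamicLimit.Theorems.MourreKoopmanChargesOneBodyCompletenessProfileClustering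
import Summits.AtomisticToContinuum.HydrodynamicLimit.Theorems.MourreKoopmanChargesOneBodyCompletenessStrongContinuity
import Summits.AtomisticToContinuum.HydrodynamicLimit.Theorems.MourreKoopmanChargesOneBodyCompletenessDynamicClusteringReduction
import Summits.AtomisticToContinuum.HydrodynamicLimit.Theorems.MourreKoopmanChargesOneBodyCompletenessFlowContinuityB
import Summits.AtomisticToContinuum.HydrodynamicLimit.Theorems.MourreKoopmanChargesOneBodyCompletenessIdentificationConjectures
import Literature.MathematicalPhysics.StatisticalMechanics.DiluteHardSphereGasProofs
import Literature.Analysis.FluidPDE.InfiniteHardSphereKoopman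
import Literature.MathematicalPhysics.KineticTheory.FluctuationSpace
import Literature.MathematicalPhysics.KineticTheory.FluctuationSpaceStone
import Literature.MathematicalPhysics.KineticTheory.HardSphereGasFluctuations
import Literature.Analysis.FluidPDE.InfiniteHardSphereFlow

/-!
# Skeleton v7 (lead c3) for the crux `OneBodyCompleteness` (stmt-AtomisticToContinuum-9583) of route
`MourreKoopmanCharges` (sub-problem `HydrodynamicLimit`), line `registered` (= `Lines/birth.lean`).

Line = the route's own two-layer plan for this crux
(`OneBodyCompleteness ⇐ ChargesCompleteHS → TorusToFluctuationSpace → OneBodyCompleteness`,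
glue: von Neumann's mean ergodic theorem in Spohn's fluctuation space `ℋ_F` + Maxwellian
orthogonality), typed over the LANDED carriers (`HardSphereFluctuationData`, `IsHardSphereGibbs`,
`InfiniteHardSphereFlow`), through the HARD-SPHERE SCALING DICTIONARY of v3–v5: the torus system at
reduced diameter `σ`, temperature `θ` (`N+1` spheres of diameter `ε_N = σ(N+1)^{-1/3}` on the unit
torus, velocities `M_θ`), blown up by `ε_N⁻¹` in space and `√θ/ε_N` in time, is `N+1` UNIT spheres at
density `σ³` with `M_1` velocities; its local limit is the infinite-volume Gibbs state at DIAMETER 1,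
INVERSE TEMPERATURE 1, density `σ³` (activity `z ≈ σ³`), the normalisation of the tree's facts
`RuelleDiluteHardSphereGas` (PROVED: `RuelleDiluteHardSphereGas_holds`) and
`Georgii1995_hardSphereCanonicalLocalLimit`, and of the route's crux #3 `ChargesCompleteHS`
(stmt-14141) at `σ = β = 1` (used BY NAME as a hypothesis of the composition).

## Status (v8, 2026-08-17, lead c3): FOUR stubs open — one named theorem and three named conjectures —
## everything else landed

OPEN (the only `sorry`s of this file):
* `stub_alexanderFlow` — NAMED FACTS `InfiniteHardSphereFlow.nonempty ∧ .unique` (Alexander 1976 Thm 5.2,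
  Cor 5.4), verbatim the sibling crux `StressStrongMixing`'s registered stub (one proof closes both);
* `stub_generatorsContinuousClustering` — OPEN CORE #1: continuous (locally-uniform-in-time) two-time
  clustering of the six generators `{n_0,…,n_4, A_g}` of the dilute unit-diameter gas under equilibrium
  flows (Doyon 2022 Def. 4.8 / Spohn 1991 Part I Condition 2.1 — an ASSUMPTION in print);
* `stub_twoTimeLocalLimitUnit` — OPEN CORE #2a, the named conjecture I1 `TwoTimeLocalLimitUnit` (p169946):
  two-time local limit of the blown-up canonical torus gas (dynamical Georgii limit; no proof in print);
* `stub_uniformTorusTwoTimeClustering` — OPEN CORE #2b, the named conjecture I2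
  `UniformTorusTwoTimeClustering` (p169946): two-time clustering of the torus gas uniformly in the period.

CLOSED this cycle (landed `--supports stmt-9583`, imported below):
* `stub_diluteGibbsStateUnit` (v5) — p161100, from `RuelleDiluteHardSphereGas_holds` + p155093;
* `stub_densityClustering` — p162886: exponential clustering of the density of the low-activity hard-core
  gas (`z < 1/32`), from the sibling's two-ball covariance bound `abs_cov_le_of_isHardSphereGibbs` (p162147);
* `stub_chargeClusteringOfDensity` — p163877: conditional-Maxwellian reduction of charge–charge truncated
  correlations to the density–density one;
* `stub_staticClusteringProfile` — p164213: pairs with `A_g`, `g ⊥ 1`, compactly supported (Campbell);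
* `stub_strongContinuityOfGenerators` — p164309: strong continuity of the Koopman group from dynamical
  continuity of the generators (isometries, group law, density of orbit classes);
* `stub_flowMeanSquareContinuity` (D2) — p168203 + p168987: right mean-square continuity of `t ↦ A_h ∘ Φ_t`
  from the flow axioms by the stationarity count (no Alexander regularity needed);
* `stub_torusIdentificationUnit` — REDUCED to I1 ∧ I2: `torusIdentificationUnit_of` p169750 (`K = σ⁻³`; exact
  decomposition of `(N+1)·E[A(Φ_t z)A(z)]` p169366, F-side inputs p169041, torus label forms p169057, named
  form p169946);
* reduction `dynamicClusteringOneBody_of` — p165274: the v6 dynamic core (two-time clustering at every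
  time + dynamical continuity at `0`) from D1 = `stub_generatorsContinuousClustering` and
  D2 = `stub_flowMeanSquareContinuity` (Doyon 2022 Thm 4.11 (III), dominated convergence; evenness in `t`
  from stationarity + a.e. group law).

Glue PROVED below: `packaging_of` (per-profile dynamical packaging on the MINIMAL observable space
`flowShiftSpan Φ (range cellCharge ∪ {cellObs g})`, assembly `Φ.fluctuationData ⟨G, …⟩` with the sibling's
`memLp_of_mem_flowShiftSpan` / `integrable_cov_of_mem_flowShiftSpan` / `integral_cov_spatialShift_nonneg` /
`memLp_two_cellObs_of_isHardSphereGibbs` / `equilibriumFlowShiftCovariant_of_unique`) and the composition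
`OneBodyCompleteness_of (hAlex) (hD1) (hI1) (hI2) (h3 : ChargesCompleteHS) : OneBodyCompleteness`
(`σ₀ := min (min σ₁ σ₃) (min 2⁻¹ (min z₀ z₂ / 2))`; packaging applied to `g := h_θ = h(√θ ·)`;
`𝒬₀ ⊆ 𝒞 ⊥ [A_{h_θ}]` by `gibbsMaxwellianOrthogonality`; Cesàro decay by the mean ergodic theorem and
`u = (√θ/σ) s`; domination `M := sup_N f_N(0)`; window passage; `δ/2 + δ/2`).
-/

namespace Summit.AtomisticToContinuum.HydrodynamicLimit.Cruxes.OneBodyCompleteness.Birth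

open scoped BigOperators Topology InnerProductSpace ENNReal
open Filter Set Function MeasureTheory ProbabilityTheory
open Literature.MathematicalPhysics.KineticTheory Literature.Analysis.FluidPDE
open Summit.AtomisticToContinuum.HydrodynamicLimit.Theses.MourreKoopmanCharges
open Summit.AtomisticToContinuum.HydrodynamicLimit.Theorems.MourreKoopmanChargesOneBodyCompleteness
  (stub_torusMoments stub_windowPassage gibbsMaxwellianOrthogonality meanErgodic tendsto_cesaro_comp_mul
    exists_forall_le_of_tendsto poly_bound_comp_sqrt orthogonal_comp_sqrt diluteGibbsStateUnit_of_ruelle)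
open Summit.AtomisticToContinuum.HydrodynamicLimit.Theorems.MourreKoopmanChargesStressStrongMixing
  (memLp_of_mem_flowShiftSpan integrable_cov_of_mem_flowShiftSpan integral_cov_spatialShift_nonneg
    memLp_two_cellObs_of_isHardSphereGibbs equilibriumFlowShiftCovariant_of_unique
    integral_cellCharge_zero_eq_toReal_density)

/-! ### v5 stub now CLOSED in the tree (no longer an obligation of the line) -/

/-- stub 1'a (v5) — DILUTE GIBBS STATE OF PRESCRIBED DENSITY at unit diameter and unit inverse
temperature: CLOSED by the tree's `RuelleDiluteHardSphereGas_holds` through the landed glue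
`diluteGibbsStateUnit_of_ruelle` (p155093; landed verbatim as
`Theorems.MourreKoopmanChargesOneBodyCompleteness.stub_diluteGibbsStateUnit`, p161100).
[Ruelle1969 Thm 4.2.3, Thm 4.3.1 + (3.12); DobrushinSinaiSukhov1989 Ch. 10 §2.4–2.5] -/
theorem stub_diluteGibbsStateUnit :
    ∃ σ₁ : ℝ, 0 < σ₁ ∧ ∀ σ : ℝ, 0 < σ → σ < σ₁ →
      ∃ (z : ℝ) (G : Measure MarkedConfig), 0 < z ∧ z ≤ 2 * σ ^ 3 ∧
        IsHardSphereGibbs 1 z 1 (0 : V3) G ∧ IsTranslationInvariant G ∧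
        PointProcess.density G = ENNReal.ofReal (σ ^ 3) :=
  Summit.AtomisticToContinuum.HydrodynamicLimit.Theorems.MourreKoopmanChargesOneBodyCompleteness.stub_diluteGibbsStateUnit

/-! ### Stubs: four still OPEN (`sorry` ONLY in `stub_alexanderFlow`, `stub_generatorsContinuousClustering`,
`stub_twoTimeLocalLimitUnit`, `stub_uniformTorusTwoTimeClustering`); the others are CLOSED by landed `Theorems/` files

The stub SIGNATURES are written over tree constants only (no skeleton-local `def`), with
`open Literature.MathematicalPhysics.KineticTheory Literature.Analysis.FluidPDE` in force, so that a
`Theorems/` file — which cannot import this workfile — can state and prove each verbatim. -/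

/-- STUB (NAMED FACTS, Alexander 1976 Thm 5.2 + Cor. 5.4): existence and uniqueness of the equilibrium
hard-sphere flow in `ℝ³` — verbatim the registered stub `stub_alexanderFlow` of the sibling crux
`StressStrongMixing` (stmt-9584). [Alexander1976 Thm 5.2, Cor 5.4; Spohn1991 Thm 1.2] -/
theorem stub_alexanderFlow :
    InfiniteHardSphereFlow.nonempty (d := Fin 3) ∧ InfiniteHardSphereFlow.unique (d := Fin 3) := by
  sorry

/-- STUB (PROVABLE, L — spatial clustering of the DENSITY of the low-activity hard-core gas): below an
activity threshold `z₃`, for every inverse temperature `β > 0` and every translation-invariant DLR Gibbs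
state `G` of unit hard spheres at activity `z < z₃` (zero drift), the density–density truncated
correlation `x ↦ Cov_G(N_C, N_C ∘ τ_x)` of the unit-cell particle number `N_C = n_0` is integrable on `ℝ³`
(exponential clustering of the low-activity hard-core gas, from the boundary-influence estimate behind
the tree's small-activity DLR uniqueness `HardSphereDLR.IsHsLocalGibbs.abs_measureReal_sub_hsLocalSpec_empty_le`:
the specification on two `σ`-separated balls factorises, each factor is within `C_k (2κ)^d` of its free
value for hard-core boundary conditions, so `|Cov_G(1_A, 1_B)| ≤ 3ε + ε²` for local events, and
`N_C ≤ 8` is a bounded local observable). [Ruelle1969 §4.4; MichelenPerkins2021 Thm 3 / §5] -/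
theorem stub_densityClustering :
    ∃ z₃ : ℝ, 0 < z₃ ∧ ∀ z β : ℝ, 0 < z → z < z₃ → 0 < β →
      ∀ G : Measure MarkedConfig, IsHardSphereGibbs 1 z β (0 : V3) G → IsTranslationInvariant G →
        Integrable (fun x : V3 => cov[cellCharge 0, cellCharge 0 ∘ spatialShift x; G]) volume :=
  Summit.AtomisticToContinuum.HydrodynamicLimit.Theorems.MourreKoopmanChargesOneBodyCompleteness.stub_densityClustering

/-- STUB (PROVABLE, M — the five cell charges cluster as soon as the density does): for every
translation-invariant DLR Gibbs state `G` of unit hard spheres (activity `z > 0`, inverse temperature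
`β > 0`, zero drift), integrability of the density–density truncated correlation implies integrability of
all charge–charge truncated correlations `x ↦ Cov_G(n_i, n_j ∘ τ_x)`: given the positions the Maxwellian
marks are i.i.d. `M_β`, so (Campbell / DLR disintegration on a window containing `C ∪ (C - x)`)
`Cov_G(n_i, n_j ∘ τ_x) = (m(e_i e_j) - m(e_i) m(e_j))·E_G[#(C ∩ (C - x))] + m(e_i) m(e_j)·Cov_G(N_C, N_{C-x})`,
`m(f) = ∫ f dM_β`, whose first term is bounded and supported in `‖x‖ < 2√3`.
[Spohn1991 Part I §7.1 (7.6)–(7.7); Alexander1976 §2.2] -/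
theorem stub_chargeClusteringOfDensity :
    ∀ z β : ℝ, 0 < z → 0 < β → ∀ G : Measure MarkedConfig, IsHardSphereGibbs 1 z β (0 : V3) G →
      IsTranslationInvariant G →
      Integrable (fun x : V3 => cov[cellCharge 0, cellCharge 0 ∘ spatialShift x; G]) volume →
      ∀ i j : Fin 5, Integrable (fun x : V3 => cov[cellCharge i, cellCharge j ∘ spatialShift x; G]) volume :=
  Summit.AtomisticToContinuum.HydrodynamicLimit.Theorems.MourreKoopmanChargesOneBodyCompleteness.stub_chargeClusteringOfDensity

/-- Static spatial clustering of the five cell charges below the activity threshold of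
`stub_densityClustering` (composition of the two stubs above). [folklore] -/
theorem staticClusteringCharges_of
    (hDn : ∃ z₃ : ℝ, 0 < z₃ ∧ ∀ z β : ℝ, 0 < z → z < z₃ → 0 < β →
      ∀ G : Measure MarkedConfig, IsHardSphereGibbs 1 z β (0 : V3) G → IsTranslationInvariant G →
        Integrable (fun x : V3 => cov[cellCharge 0, cellCharge 0 ∘ spatialShift x; G]) volume)
    (hCh : ∀ z β : ℝ, 0 < z → 0 < β → ∀ G : Measure MarkedConfig, IsHardSphereGibbs 1 z β (0 : V3) G →
      IsTranslationInvariant G →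
      Integrable (fun x : V3 => cov[cellCharge 0, cellCharge 0 ∘ spatialShift x; G]) volume →
      ∀ i j : Fin 5, Integrable (fun x : V3 => cov[cellCharge i, cellCharge j ∘ spatialShift x; G]) volume) :
    ∃ z₃ : ℝ, 0 < z₃ ∧ ∀ z β : ℝ, 0 < z → z < z₃ → 0 < β →
      ∀ G : Measure MarkedConfig, IsHardSphereGibbs 1 z β (0 : V3) G → IsTranslationInvariant G →
        ∀ i j : Fin 5, Integrable (fun x : V3 => cov[cellCharge i, cellCharge j ∘ spatialShift x; G]) volume := by
  obtain ⟨z₃, hz₃, H⟩ := hDn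
  exact ⟨z₃, hz₃, fun z β hz hzlt hβ G hG hti i j => hCh z β hz hβ G hG hti (H z β hz hzlt hβ G hG hti) i j⟩

/-- STUB (PROVABLE, M — static clustering of the profile pairs): for every DLR Gibbs state `G` of unit
hard spheres at unit inverse temperature and every continuous polynomially bounded profile `g ⊥ 1` in
`L²(M_1)`, the truncated correlations pairing the one-body cell observable `A_g` with the six generators
are integrable in the shift — indeed compactly supported: by the DLR Campbell formula
(`gibbsCampbellSecondMoment`, p156986) `Cov_G(A_g, A_e ∘ τ_x) = (∫ g e dM_1)·E_G[#(C ∩ (C - x))]`, which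
vanishes once the unit cell and its translate are disjoint. [Spohn1991 Part I §7.1 (7.6)–(7.7)] -/
theorem stub_staticClusteringProfile :
    ∀ z : ℝ, 0 < z → ∀ G : Measure MarkedConfig, IsHardSphereGibbs 1 z 1 (0 : V3) G → IsTranslationInvariant G →
      ∀ g : V3 → ℝ, Continuous g → (∃ (C : ℝ) (k : ℕ), ∀ v, |g v| ≤ C * (1 + ‖v‖) ^ k) →
        (∫ v, g v * localMaxwellian 1 1 (0 : V3) v = 0) →
        ∀ a ∈ Set.range cellCharge ∪ {cellObs g},
          Integrable (fun x : V3 => cov[a, cellObs g ∘ spatialShift x; G]) volume ∧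
          Integrable (fun x : V3 => cov[cellObs g, a ∘ spatialShift x; G]) volume :=
  Summit.AtomisticToContinuum.HydrodynamicLimit.Theorems.MourreKoopmanChargesOneBodyCompleteness.stub_staticClusteringProfile

/-- STUB (OPEN dynamic core #1 — CONTINUOUS CLUSTERING of the six generators, Doyon 2022 Def. 4.8 /
Spohn 1991 Part I Condition 2.1, ASSUMED in print): below an activity threshold `z₄`, for every
unit-diameter equilibrium flow `Φ`, every translation-invariant DLR state `G` of unit hard spheres at unit
inverse temperature and activity `z < z₄`, every continuous polynomially bounded profile `g ⊥ 1` whose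
six generators `{n_0,…,n_4, A_g}` cluster statically, and every pair of generators `a, b` and horizon
`T`: ONE integrable majorant of the two-time truncated two-point function `|Cov_G(a, (b ∘ Φ_t) ∘ τ_x)|`
off one ball, uniform in `|t| ≤ T` (locality of the hard-sphere dynamics in `L²`; no finite speed of
propagation). Verbatim the first hypothesis of the landed reduction `dynamicClusteringOneBody_of`
(p165274). [Doyon2022 Def. 4.3–4.4, 4.8; Spohn1991 Part I §7.1 (7.6), Condition 2.1] -/
theorem stub_generatorsContinuousClustering :
    ∃ z₄ : ℝ, 0 < z₄ ∧ ∀ Φ : InfiniteHardSphereFlow (Fin 3) 1, Φ.IsEquilibriumFlow →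
      ∀ z : ℝ, 0 < z → z < z₄ → ∀ G : Measure MarkedConfig, IsHardSphereGibbs 1 z 1 (0 : V3) G →
        IsTranslationInvariant G →
        ∀ g : V3 → ℝ, Continuous g → (∃ (C : ℝ) (k : ℕ), ∀ v, |g v| ≤ C * (1 + ‖v‖) ^ k) →
          (∫ v, g v * localMaxwellian 1 1 (0 : V3) v = 0) →
          (∀ a ∈ Set.range cellCharge ∪ {cellObs g}, ∀ b ∈ Set.range cellCharge ∪ {cellObs g},
              Integrable (fun x : V3 => cov[a, b ∘ spatialShift x; G]) volume) →
          ∀ a ∈ Set.range cellCharge ∪ {cellObs g}, ∀ b ∈ Set.range cellCharge ∪ {cellObs g}, ∀ T : ℝ,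
            ∃ F : V3 → ℝ, Integrable F volume ∧ ∃ R : ℝ, ∀ t : ℝ, |t| ≤ T →
              ∀ x : V3, R ≤ ‖x‖ → |cov[a, (b ∘ Φ.flow t) ∘ spatialShift x; G]| ≤ F x := by
  sorry

/-- (CLOSED, p168203 + p168987) RIGHT MEAN-SQUARE CONTINUITY OF THE FLOW ON ONE-BODY CELL OBSERVABLES: for
every unit-diameter equilibrium flow `Φ`, every DLR state `G` of unit hard spheres at unit inverse
temperature (any activity) and every continuous polynomially bounded profile `h`,
`∫ (A_h ∘ Φ_t - A_h)² dG → 0` as `t → 0⁺`. Verbatim the second hypothesis of the landed reduction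
`dynamicClusteringOneBody_of` (p165274). Provable from the flow axioms WITHOUT Alexander's regularity
4.8 (b), by a stationarity count: with `M_t(ω) = #{p ∈ ω ∩ C : f_t(p) := (q + t v, v) ∈ Φ_t ω, q + t v ∈ C}`
(measurable: `PointConfig.measurable_toMeasure_preimage`) one has `M_t ≤ N_C ∘ Φ_t` surely (the free
images are distinct points of `Φ_t ω` over `C`), `M_t → N_C` a.s. as `t → 0⁺` (each particle of `ω`
over the OPEN cell flies freely up to its first collision time, which is `> 0` by `locFinite` and path
continuity; no particle sits on `∂C` a.s.), `E_G N_C ∘ Φ_t = E_G N_C` (stationarity), whence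
`E_G[N_C ∘ Φ_t - M_t] → 0`: with probability `→ 1` the cell content at time `t` is EXACTLY the free
image of the time-`0` content, so `A_h ∘ Φ_t - Â_t → 0` in probability with
`Â_t(ω) = Σ_{p counted in M_t} h(v) → A_h` a.s. and dominatedly; uniform integrability of `(A_h ∘ Φ_t)²`
(equidistribution) finishes (Vitali). [Doyon2022 Def. 4.8 (strong continuity); Alexander1976 Thm 5.2] -/
theorem stub_flowMeanSquareContinuity :
    ∀ Φ : InfiniteHardSphereFlow (Fin 3) 1, Φ.IsEquilibriumFlow → ∀ z : ℝ, 0 < z →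
      ∀ G : Measure MarkedConfig, IsHardSphereGibbs 1 z 1 (0 : V3) G →
        ∀ h : V3 → ℝ, Continuous h → (∃ (C : ℝ) (k : ℕ), ∀ v, |h v| ≤ C * (1 + ‖v‖) ^ k) →
          Tendsto (fun t : ℝ => ∫ ω, (cellObs h (Φ.flow t ω) - cellObs h ω) ^ 2 ∂G) (𝓝[≥] 0) (𝓝 0) :=
  Summit.AtomisticToContinuum.HydrodynamicLimit.Theorems.MourreKoopmanChargesOneBodyCompleteness.stub_flowMeanSquareContinuity

/-- The v6 open dynamic core (two-time clustering at every time + dynamical continuity at `t = 0` of the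
six generators), now DERIVED from the two stubs above by the landed reduction
`dynamicClusteringOneBody_of` (p165274; Doyon 2022 Thm 4.11 (III) by dominated convergence).
[Doyon2022 Thm 4.11 (III)] -/
theorem stub_dynamicClusteringOneBody :
    ∃ z₄ : ℝ, 0 < z₄ ∧ ∀ Φ : InfiniteHardSphereFlow (Fin 3) 1, Φ.IsEquilibriumFlow →
      ∀ z : ℝ, 0 < z → z < z₄ → ∀ G : Measure MarkedConfig, IsHardSphereGibbs 1 z 1 (0 : V3) G →
        IsTranslationInvariant G →
        ∀ g : V3 → ℝ, Continuous g → (∃ (C : ℝ) (k : ℕ), ∀ v, |g v| ≤ C * (1 + ‖v‖) ^ k) →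
          (∫ v, g v * localMaxwellian 1 1 (0 : V3) v = 0) →
          (∀ a ∈ Set.range cellCharge ∪ {cellObs g}, ∀ b ∈ Set.range cellCharge ∪ {cellObs g},
              Integrable (fun x : V3 => cov[a, b ∘ spatialShift x; G]) volume) →
          (∀ a ∈ Set.range cellCharge ∪ {cellObs g}, ∀ b ∈ Set.range cellCharge ∪ {cellObs g}, ∀ t : ℝ,
              Integrable (fun x : V3 => cov[a, (b ∘ Φ.flow t) ∘ spatialShift x; G]) volume) ∧
          (∀ b ∈ Set.range cellCharge ∪ {cellObs g},
              ContinuousAt (fun t : ℝ => ∫ x : V3, cov[b, (b ∘ Φ.flow t) ∘ spatialShift x; G]) 0) :=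
  Summit.AtomisticToContinuum.HydrodynamicLimit.Theorems.MourreKoopmanChargesOneBodyCompleteness.dynamicClusteringOneBody_of
    stub_generatorsContinuousClustering stub_flowMeanSquareContinuity

/-- STUB (PROVABLE, M — strong continuity from the generators): for hard-sphere fluctuation data `F`
whose flow is (pointwise) the flow of `Φ` and whose local observables are the flow–shift span of a
generating set `S`, continuity at `t = 0` of the space-integrated autocorrelation
`t ↦ ∫ Cov(b, (b ∘ Φ_t) ∘ τ_x) dx` of each GENERATOR `b ∈ S` already forces strong continuity of the
whole Koopman group: `‖U_t[b] - [b]‖² = 2(⟨⟨b,b⟩⟩ - ⟨⟨b, b∘Φ_t⟩⟩)` gives continuity of `t ↦ U_t[b]`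
(isometries + group law), the continuity set is a closed subspace, and the classes of the span are
spanned — up to null observables — by the orbit classes `[b ∘ Φ_s ∘ τ_y] = U_s[b]`, which are dense.
[Doyon2022 Thm 4.11 (III); ReedSimon1972 Thm VIII.7] -/
theorem stub_strongContinuityOfGenerators :
    ∀ (ε : ℝ) (F : HardSphereFluctuationData ε) (Φ : InfiniteHardSphereFlow (Fin 3) ε)
      (S : Set (MarkedConfig → ℝ)), (∀ t : ℝ, F.flow t = Φ.flow t) → F.localObs = flowShiftSpan Φ S →
      (∀ b ∈ S, ContinuousAt (fun t : ℝ => ∫ x : V3, cov[b, (b ∘ Φ.flow t) ∘ spatialShift x; F.μ]) 0) →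
      ∀ ψ : HardSphereFluctuationSpace F, Continuous fun t : ℝ => F.koopman t ψ :=
  Summit.AtomisticToContinuum.HydrodynamicLimit.Theorems.MourreKoopmanChargesOneBodyCompleteness.stub_strongContinuityOfGenerators

/-- STUB (OPEN core #2a — NAMED CONJECTURE I1, `TwoTimeLocalLimitUnit`, landed as `@[conjecture]` in
`Theorems/…OneBodyCompletenessIdentificationConjectures.lean`, p169946): the two-time local limit of the
blown-up canonical torus gas at unit normalisation — the dynamical, two-time, one-body version of the named
fact `Georgii1995_hardSphereCanonicalLocalLimit` (content: locality in probability of the hard-sphere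
dynamics uniformly in `N` + equivalence of ensembles + low-density DLR uniqueness + Alexander's
uniqueness; no proof in print). [Spohn1991 Part I §7.1 (7.14)–(7.15); Georgii1995 Thms 3.3–3.4;
Alexander1976 Prop 5.1, Thm 5.2, Cor 5.4] -/
theorem stub_twoTimeLocalLimitUnit :
    Summit.AtomisticToContinuum.HydrodynamicLimit.Theorems.MourreKoopmanChargesOneBodyCompleteness.TwoTimeLocalLimitUnit := by
  sorry

/-- STUB (OPEN core #2b — NAMED CONJECTURE I2, `UniformTorusTwoTimeClustering`, landed as `@[conjecture]`,
p169946): two-time clustering of the canonical torus gas at fixed microscopic time, uniformly in the period,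
for centred profiles `h ⊥ 1` and measurable cell weights `|w|, |w'| ≤ 1` (the torus counterpart of the
clustering field `integrable_cov`; Spohn 1991 Part I Condition 2.1 assumes it; false without `h ⊥ 1` by the
canonical constraint, Lebowitz–Percus–Verlet). [Spohn1991 Part I §2.2 Condition 2.1, §7.1 (7.6);
Doyon2022 Def. 4.3–4.4; LebowitzPercusVerlet1967 §II] -/
theorem stub_uniformTorusTwoTimeClustering :
    Summit.AtomisticToContinuum.HydrodynamicLimit.Theorems.MourreKoopmanChargesOneBodyCompleteness.UniformTorusTwoTimeClustering := by
  sorry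

/-- (REDUCED to I1 ∧ I2 by the landed `torusIdentificationUnit_of`, p169750, `K = σ⁻³`; exact decomposition
`decomposition_twoTimeMoment` p169366, F-side inputs p169041, torus label forms p169057) — DIAGONAL TORUS ↔
INFINITE-VOLUME IDENTIFICATION through the hard-sphere scaling (support item 9702 (2), typed; unchanged since
v3; its `s = 0` instance is PROVED, `torusIdentificationUnit_static`, p159141, with `K = σ⁻³`): there is an activity threshold `z₂` such
that for `0 < σ < 1/2`, `0 < z < z₂`, `θ > 0`, every unit-diameter, unit-inverse-temperature Gibbs
fluctuation datum `F` of density `σ³` carried by Alexander's flow identifies the `(N+1)`-rescaled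
equilibrium two-time AUTOcovariance of the one-body empirical field `A_h(χ)` on `𝕋³` (`N+1` spheres of
diameter `σ(N+1)^{-1/3}`, canonical law `localGibbsLaw σ 1 0 θ`, flow time `s(N+1)^{-1/3}`) in the limit
`N → ∞` with `(∫χ²)·K·⟪U_{(√θ/σ)s}[A_{h_θ}], [A_{h_θ}]⟫_{ℋ_F}`, `h_θ(w) = h(√θ w)`, for some constant `K`
and every continuous polynomially bounded `h ⊥ {1, v, |v|²}` in `L²(M_θ)` with `A_{h_θ} ∈ 𝒱`
(locality in law of the dynamics on the blown-up torus at fixed microscopic time + equivalence of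
ensembles + clustering uniform in `N`; the canonical `k = 0` correction `∝ ⟪[A_{h_θ}], q₀⟫²` vanishes
for `h ⊥ 1`). [Spohn1991 Part I §7.1 (7.14)–(7.15); Alexander1976 Prop 5.1/Thm 5.2; Georgii1995 Thms
3.3–3.4; LebowitzPercusVerlet1967; Ruelle1969 Thm 4.2.3] -/
theorem stub_torusIdentificationUnit :
    ∃ z₂ : ℝ, 0 < z₂ ∧ ∀ σ : ℝ, 0 < σ → σ < 1 / 2 → ∀ z : ℝ, 0 < z → z < z₂ → ∀ θ : ℝ, 0 < θ →
      ∀ F : Literature.MathematicalPhysics.KineticTheory.HardSphereFluctuationData 1,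
        Literature.Analysis.FluidPDE.IsHardSphereGibbs 1 z 1
          (0 : Literature.MathematicalPhysics.KineticTheory.V3) F.μ →
        (∃ Φ : Literature.Analysis.FluidPDE.InfiniteHardSphereFlow (Fin 3) 1,
          Φ.IsEquilibriumFlow ∧ ∀ t : ℝ, F.flow t =ᵐ[F.μ] Φ.flow t) →
        (∫ ω, Literature.MathematicalPhysics.KineticTheory.cellCharge 0 ω ∂F.μ = σ ^ 3) →
        ∀ h : Literature.MathematicalPhysics.KineticTheory.V3 → ℝ, Continuous h →
          (∃ (C : ℝ) (k : ℕ), ∀ v, |h v| ≤ C * (1 + ‖v‖) ^ k) →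
          Literature.MathematicalPhysics.KineticTheory.cellObs (fun w => h (Real.sqrt θ • w)) ∈ F.localObs →
          (∫ v, h v * Literature.Analysis.FluidPDE.localMaxwellian 1 θ
              (0 : Literature.MathematicalPhysics.KineticTheory.V3) v = 0) →
          (∀ i : Fin 3, ∫ v, h v * v i * Literature.Analysis.FluidPDE.localMaxwellian 1 θ
              (0 : Literature.MathematicalPhysics.KineticTheory.V3) v = 0) →
          (∫ v, h v * ‖v‖ ^ 2 * Literature.Analysis.FluidPDE.localMaxwellian 1 θ
              (0 : Literature.MathematicalPhysics.KineticTheory.V3) v = 0) →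
          ∃ K : ℝ, ∀ Φ : (N : ℕ) → Literature.Analysis.FluidPDE.HardSphereFlow
              (Literature.Analysis.FluidPDE.Torus.geometry (Fin 3))
              (Literature.MathematicalPhysics.KineticTheory.hsDiameter σ N) (N + 1),
          ∀ χ : Literature.MathematicalPhysics.KineticTheory.T3 → ℝ, Continuous χ → ∀ s : ℝ,
            Tendsto (fun N : ℕ => ((N : ℝ) + 1) *
                cov[fun z => ∫ y, χ y.1 * h y.2 ∂(Literature.Analysis.FluidPDE.empiricalMeasure
                      ((Φ N).flow (s * ((N : ℝ) + 1) ^ (-(1 / 3 : ℝ))) z)),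
                    fun z => ∫ y, χ y.1 * h y.2 ∂(Literature.Analysis.FluidPDE.empiricalMeasure z);
                  Literature.MathematicalPhysics.KineticTheory.localGibbsLaw σ (fun _ => 1)
                    (fun _ => 0) (fun _ => θ) N (Φ N)])
              atTop (𝓝 ((∫ x, χ x * χ x) * K *
                ⟪F.koopman (Real.sqrt θ / σ * s)
                    (F.fluct (Literature.MathematicalPhysics.KineticTheory.cellObs
                      (fun w => h (Real.sqrt θ • w)))),
                  F.fluct (Literature.MathematicalPhysics.KineticTheory.cellObs
                    (fun w => h (Real.sqrt θ • w)))⟫_ℝ)) :=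
  Summit.AtomisticToContinuum.HydrodynamicLimit.Theorems.MourreKoopmanChargesOneBodyCompleteness.torusIdentificationUnit_of_conjectures
    stub_twoTimeLocalLimitUnit stub_uniformTorusTwoTimeClustering

/-! ### Name-keyed aliases of the stub statements (verbatim; see the wiring `example` at the end) -/
namespace Registered

/-- Verbatim statement of the registered stub `stub_alexanderFlow`. -/
abbrev stub_alexanderFlow : Prop :=
    InfiniteHardSphereFlow.nonempty (d := Fin 3) ∧ InfiniteHardSphereFlow.unique (d := Fin 3)

/-- Verbatim statement of the registered stub `stub_densityClustering`. -/
abbrev stub_densityClustering : Prop :=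
    ∃ z₃ : ℝ, 0 < z₃ ∧ ∀ z β : ℝ, 0 < z → z < z₃ → 0 < β →
      ∀ G : Measure MarkedConfig, IsHardSphereGibbs 1 z β (0 : V3) G → IsTranslationInvariant G →
        Integrable (fun x : V3 => cov[cellCharge 0, cellCharge 0 ∘ spatialShift x; G]) volume

/-- Verbatim statement of the registered stub `stub_chargeClusteringOfDensity`. -/
abbrev stub_chargeClusteringOfDensity : Prop :=
    ∀ z β : ℝ, 0 < z → 0 < β → ∀ G : Measure MarkedConfig, IsHardSphereGibbs 1 z β (0 : V3) G →
      IsTranslationInvariant G →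
      Integrable (fun x : V3 => cov[cellCharge 0, cellCharge 0 ∘ spatialShift x; G]) volume →
      ∀ i j : Fin 5, Integrable (fun x : V3 => cov[cellCharge i, cellCharge j ∘ spatialShift x; G]) volume

/-- The v6.1 statement of the static clustering of the charges (now DERIVED from the two stubs above by
`staticClusteringCharges_of`; kept as the hypothesis shape of the glue below). -/
abbrev stub_staticClusteringCharges : Prop :=
    ∃ z₃ : ℝ, 0 < z₃ ∧ ∀ z β : ℝ, 0 < z → z < z₃ → 0 < β →
      ∀ G : Measure MarkedConfig, IsHardSphereGibbs 1 z β (0 : V3) G → IsTranslationInvariant G →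
        ∀ i j : Fin 5, Integrable (fun x : V3 => cov[cellCharge i, cellCharge j ∘ spatialShift x; G]) volume

/-- Verbatim statement of the registered stub `stub_staticClusteringProfile`. -/
abbrev stub_staticClusteringProfile : Prop :=
    ∀ z : ℝ, 0 < z → ∀ G : Measure MarkedConfig, IsHardSphereGibbs 1 z 1 (0 : V3) G → IsTranslationInvariant G →
      ∀ g : V3 → ℝ, Continuous g → (∃ (C : ℝ) (k : ℕ), ∀ v, |g v| ≤ C * (1 + ‖v‖) ^ k) →
        (∫ v, g v * localMaxwellian 1 1 (0 : V3) v = 0) →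
        ∀ a ∈ Set.range cellCharge ∪ {cellObs g},
          Integrable (fun x : V3 => cov[a, cellObs g ∘ spatialShift x; G]) volume ∧
          Integrable (fun x : V3 => cov[cellObs g, a ∘ spatialShift x; G]) volume

/-- Verbatim statement of the registered stub `stub_dynamicClusteringOneBody`. -/
abbrev stub_dynamicClusteringOneBody : Prop :=
    ∃ z₄ : ℝ, 0 < z₄ ∧ ∀ Φ : InfiniteHardSphereFlow (Fin 3) 1, Φ.IsEquilibriumFlow →
      ∀ z : ℝ, 0 < z → z < z₄ → ∀ G : Measure MarkedConfig, IsHardSphereGibbs 1 z 1 (0 : V3) G →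
        IsTranslationInvariant G →
        ∀ g : V3 → ℝ, Continuous g → (∃ (C : ℝ) (k : ℕ), ∀ v, |g v| ≤ C * (1 + ‖v‖) ^ k) →
          (∫ v, g v * localMaxwellian 1 1 (0 : V3) v = 0) →
          (∀ a ∈ Set.range cellCharge ∪ {cellObs g}, ∀ b ∈ Set.range cellCharge ∪ {cellObs g},
              Integrable (fun x : V3 => cov[a, b ∘ spatialShift x; G]) volume) →
          (∀ a ∈ Set.range cellCharge ∪ {cellObs g}, ∀ b ∈ Set.range cellCharge ∪ {cellObs g}, ∀ t : ℝ,
              Integrable (fun x : V3 => cov[a, (b ∘ Φ.flow t) ∘ spatialShift x; G]) volume) ∧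
          (∀ b ∈ Set.range cellCharge ∪ {cellObs g},
              ContinuousAt (fun t : ℝ => ∫ x : V3, cov[b, (b ∘ Φ.flow t) ∘ spatialShift x; G]) 0)

/-- Verbatim statement of the registered stub `stub_generatorsContinuousClustering`. -/
abbrev stub_generatorsContinuousClustering : Prop :=
    ∃ z₄ : ℝ, 0 < z₄ ∧ ∀ Φ : InfiniteHardSphereFlow (Fin 3) 1, Φ.IsEquilibriumFlow →
      ∀ z : ℝ, 0 < z → z < z₄ → ∀ G : Measure MarkedConfig, IsHardSphereGibbs 1 z 1 (0 : V3) G →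
        IsTranslationInvariant G →
        ∀ g : V3 → ℝ, Continuous g → (∃ (C : ℝ) (k : ℕ), ∀ v, |g v| ≤ C * (1 + ‖v‖) ^ k) →
          (∫ v, g v * localMaxwellian 1 1 (0 : V3) v = 0) →
          (∀ a ∈ Set.range cellCharge ∪ {cellObs g}, ∀ b ∈ Set.range cellCharge ∪ {cellObs g},
              Integrable (fun x : V3 => cov[a, b ∘ spatialShift x; G]) volume) →
          ∀ a ∈ Set.range cellCharge ∪ {cellObs g}, ∀ b ∈ Set.range cellCharge ∪ {cellObs g}, ∀ T : ℝ,
            ∃ F : V3 → ℝ, Integrable F volume ∧ ∃ R : ℝ, ∀ t : ℝ, |t| ≤ T →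
              ∀ x : V3, R ≤ ‖x‖ → |cov[a, (b ∘ Φ.flow t) ∘ spatialShift x; G]| ≤ F x

/-- Verbatim statement of the registered stub `stub_flowMeanSquareContinuity`. -/
abbrev stub_flowMeanSquareContinuity : Prop :=
    ∀ Φ : InfiniteHardSphereFlow (Fin 3) 1, Φ.IsEquilibriumFlow → ∀ z : ℝ, 0 < z →
      ∀ G : Measure MarkedConfig, IsHardSphereGibbs 1 z 1 (0 : V3) G →
        ∀ h : V3 → ℝ, Continuous h → (∃ (C : ℝ) (k : ℕ), ∀ v, |h v| ≤ C * (1 + ‖v‖) ^ k) →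
          Tendsto (fun t : ℝ => ∫ ω, (cellObs h (Φ.flow t ω) - cellObs h ω) ^ 2 ∂G) (𝓝[≥] 0) (𝓝 0)

/-- Verbatim statement of the registered stub `stub_strongContinuityOfGenerators`. -/
abbrev stub_strongContinuityOfGenerators : Prop :=
    ∀ (ε : ℝ) (F : HardSphereFluctuationData ε) (Φ : InfiniteHardSphereFlow (Fin 3) ε)
      (S : Set (MarkedConfig → ℝ)), (∀ t : ℝ, F.flow t = Φ.flow t) → F.localObs = flowShiftSpan Φ S →
      (∀ b ∈ S, ContinuousAt (fun t : ℝ => ∫ x : V3, cov[b, (b ∘ Φ.flow t) ∘ spatialShift x; F.μ]) 0) →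
      ∀ ψ : HardSphereFluctuationSpace F, Continuous fun t : ℝ => F.koopman t ψ

/-- Verbatim statement of the registered stub `stub_twoTimeLocalLimitUnit`. -/
abbrev stub_twoTimeLocalLimitUnit : Prop :=
    Summit.AtomisticToContinuum.HydrodynamicLimit.Theorems.MourreKoopmanChargesOneBodyCompleteness.TwoTimeLocalLimitUnit

/-- Verbatim statement of the registered stub `stub_uniformTorusTwoTimeClustering`. -/
abbrev stub_uniformTorusTwoTimeClustering : Prop :=
    Summit.AtomisticToContinuum.HydrodynamicLimit.Theorems.MourreKoopmanChargesOneBodyCompleteness.UniformTorusTwoTimeClustering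

/-- Verbatim statement of the registered stub `stub_torusIdentificationUnit`. -/
abbrev stub_torusIdentificationUnit : Prop :=
    ∃ z₂ : ℝ, 0 < z₂ ∧ ∀ σ : ℝ, 0 < σ → σ < 1 / 2 → ∀ z : ℝ, 0 < z → z < z₂ → ∀ θ : ℝ, 0 < θ →
      ∀ F : Literature.MathematicalPhysics.KineticTheory.HardSphereFluctuationData 1,
        Literature.Analysis.FluidPDE.IsHardSphereGibbs 1 z 1
          (0 : Literature.MathematicalPhysics.KineticTheory.V3) F.μ →
        (∃ Φ : Literature.Analysis.FluidPDE.InfiniteHardSphereFlow (Fin 3) 1,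
          Φ.IsEquilibriumFlow ∧ ∀ t : ℝ, F.flow t =ᵐ[F.μ] Φ.flow t) →
        (∫ ω, Literature.MathematicalPhysics.KineticTheory.cellCharge 0 ω ∂F.μ = σ ^ 3) →
        ∀ h : Literature.MathematicalPhysics.KineticTheory.V3 → ℝ, Continuous h →
          (∃ (C : ℝ) (k : ℕ), ∀ v, |h v| ≤ C * (1 + ‖v‖) ^ k) →
          Literature.MathematicalPhysics.KineticTheory.cellObs (fun w => h (Real.sqrt θ • w)) ∈ F.localObs →
          (∫ v, h v * Literature.Analysis.FluidPDE.localMaxwellian 1 θ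
              (0 : Literature.MathematicalPhysics.KineticTheory.V3) v = 0) →
          (∀ i : Fin 3, ∫ v, h v * v i * Literature.Analysis.FluidPDE.localMaxwellian 1 θ
              (0 : Literature.MathematicalPhysics.KineticTheory.V3) v = 0) →
          (∫ v, h v * ‖v‖ ^ 2 * Literature.Analysis.FluidPDE.localMaxwellian 1 θ
              (0 : Literature.MathematicalPhysics.KineticTheory.V3) v = 0) →
          ∃ K : ℝ, ∀ Φ : (N : ℕ) → Literature.Analysis.FluidPDE.HardSphereFlow
              (Literature.Analysis.FluidPDE.Torus.geometry (Fin 3))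
              (Literature.MathematicalPhysics.KineticTheory.hsDiameter σ N) (N + 1),
          ∀ χ : Literature.MathematicalPhysics.KineticTheory.T3 → ℝ, Continuous χ → ∀ s : ℝ,
            Tendsto (fun N : ℕ => ((N : ℝ) + 1) *
                cov[fun z => ∫ y, χ y.1 * h y.2 ∂(Literature.Analysis.FluidPDE.empiricalMeasure
                      ((Φ N).flow (s * ((N : ℝ) + 1) ^ (-(1 / 3 : ℝ))) z)),
                    fun z => ∫ y, χ y.1 * h y.2 ∂(Literature.Analysis.FluidPDE.empiricalMeasure z);
                  Literature.MathematicalPhysics.KineticTheory.localGibbsLaw σ (fun _ => 1)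
                    (fun _ => 0) (fun _ => θ) N (Φ N)])
              atTop (𝓝 ((∫ x, χ x * χ x) * K *
                ⟪F.koopman (Real.sqrt θ / σ * s)
                    (F.fluct (Literature.MathematicalPhysics.KineticTheory.cellObs
                      (fun w => h (Real.sqrt θ • w)))),
                  F.fluct (Literature.MathematicalPhysics.KineticTheory.cellObs
                    (fun w => h (Real.sqrt θ • w)))⟫_ℝ))

end Registered

/-! ### Glue (PROVED): the per-profile dynamical packaging from the five framework stubs -/

/-- Every element of the flow–shift span of measurable generators is measurable (minimality against the
submodule of measurable functions; flow maps and translations are measurable). [folklore] -/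
theorem measurable_of_mem_flowShiftSpan {ε : ℝ} (Φ : InfiniteHardSphereFlow (Fin 3) ε) {S : Set (MarkedConfig → ℝ)}
    (hS : ∀ a ∈ S, Measurable a) {f : MarkedConfig → ℝ} (hf : f ∈ flowShiftSpan Φ S) : Measurable f := by
  let W : Submodule ℝ (MarkedConfig → ℝ) :=
    { carrier := {g | Measurable g}
      zero_mem' := measurable_const
      add_mem' := fun hg hg' => Measurable.add hg hg'
      smul_mem' := fun c g hg => Measurable.const_smul (hg : Measurable g) c }
  have hle : flowShiftSpan Φ S ≤ W :=
    flowShiftSpan_le (fun a ha => hS a ha) (fun t g hg => (hg : Measurable g).comp (Φ.measurable_flow t))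
      (fun x g hg => (hg : Measurable g).comp (Literature.Analysis.FunctionSpaces.PointConfig.measurable_translate _))
  exact hle hf

/-- The six generators `{n_0, …, n_4, A_g}` (continuous profile `g`) are measurable. [folklore] -/
theorem measurable_generators {g : V3 → ℝ} (hg : Continuous g) :
    ∀ a ∈ Set.range cellCharge ∪ {cellObs g}, Measurable a := by
  rintro a (⟨i, rfl⟩ | ha)
  · exact measurable_cellCharge i
  · rw [Set.mem_singleton_iff] at ha
    rw [ha]
    exact measurable_cellObs hg.measurable

/-- The six generators are square integrable under every unit-diameter DLR state at unit inverse
temperature (landed `memLp_two_cellObs_of_isHardSphereGibbs`: conditional-Maxwellian moments through the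
hard-core bound on the cell count). [folklore] -/
theorem memLp_generators {z : ℝ} (hz : 0 < z) {G : Measure MarkedConfig} (hG : IsHardSphereGibbs 1 z 1 (0 : V3) G)
    {g : V3 → ℝ} (hg : Continuous g) (hb : ∃ (C : ℝ) (k : ℕ), ∀ v, |g v| ≤ C * (1 + ‖v‖) ^ k) :
    ∀ a ∈ Set.range cellCharge ∪ {cellObs g}, MemLp a 2 G := by
  have hG' : IsHardSphereGibbs 1 z (1 : ℝ)⁻¹ (0 : V3) G := by rw [inv_one]; exact hG
  rintro a (⟨i, rfl⟩ | ha)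
  · exact memLp_two_cellObs_of_isHardSphereGibbs hz.le one_pos hG' (continuous_chargeFn i).measurable (C := 1) (n := 2)
      fun v => by simpa only [one_mul] using abs_chargeFn_le i v
  · rw [Set.mem_singleton_iff.1 ha]
    obtain ⟨C, k, hC⟩ := hb
    exact memLp_two_cellObs_of_isHardSphereGibbs hz.le one_pos hG' hg.measurable hC

/-- **Static clustering of all generator pairs** from the two static stubs: charge–charge pairs by
`stub_staticClusteringCharges` (at `β = 1`), pairs with `A_g` by `stub_staticClusteringProfile`. [folklore] -/
theorem staticClustering_generators (hC : Registered.stub_staticClusteringCharges)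
    (hP : Registered.stub_staticClusteringProfile) :
    ∃ z₃ : ℝ, 0 < z₃ ∧ ∀ z : ℝ, 0 < z → z < z₃ → ∀ G : Measure MarkedConfig, IsHardSphereGibbs 1 z 1 (0 : V3) G →
      IsTranslationInvariant G →
      ∀ g : V3 → ℝ, Continuous g → (∃ (C : ℝ) (k : ℕ), ∀ v, |g v| ≤ C * (1 + ‖v‖) ^ k) →
        (∫ v, g v * localMaxwellian 1 1 (0 : V3) v = 0) →
        ∀ a ∈ Set.range cellCharge ∪ {cellObs g}, ∀ b ∈ Set.range cellCharge ∪ {cellObs g},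
          Integrable (fun x : V3 => cov[a, b ∘ spatialShift x; G]) volume := by
  obtain ⟨z₃, hz₃, H⟩ := hC
  refine ⟨z₃, hz₃, fun z hz hzlt G hG hti g hg hb hg0 => ?_⟩
  rintro a ha b (⟨j, rfl⟩ | hb')
  · rcases ha with ⟨i, rfl⟩ | ha'
    · exact H z 1 hz hzlt one_pos G hG hti i j
    · rw [Set.mem_singleton_iff.1 ha']
      exact (hP z hz G hG hti g hg hb hg0 (cellCharge j) (Or.inl ⟨j, rfl⟩)).2
  · rw [Set.mem_singleton_iff.1 hb']
    exact (hP z hz G hG hti g hg hb hg0 a ha).1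

/-- **The minimal observable space is admissible**: for a unit-diameter equilibrium flow `Φ` commuting
with the shifts `G`-a.e., a translation-invariant DLR state `G` at unit inverse temperature, and a profile
`g` whose six generators are in `L²(G)` and cluster at every pair of times,
`IsLocalObservableSpace Φ G (flowShiftSpan Φ {n_i, A_g})` — `L²` and clustering by the landed span
reductions, positivity of the structure factor by the landed Følner lemma. [folklore] -/
theorem isLocalObservableSpace_min {z : ℝ} (hz : 0 < z) {Φ : InfiniteHardSphereFlow (Fin 3) 1}
    (hΦ : Φ.IsEquilibriumFlow) {G : Measure MarkedConfig} (hG : IsHardSphereGibbs 1 z 1 (0 : V3) G)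
    (hti : IsTranslationInvariant G)
    (hcomm : ∀ (t : ℝ) (x : V3), Φ.flow t ∘ spatialShift x =ᵐ[G] spatialShift x ∘ Φ.flow t)
    {g : V3 → ℝ} (hg : Continuous g)
    (hmom : ∀ a ∈ Set.range cellCharge ∪ {cellObs g}, MemLp a 2 G)
    (hcl : ∀ a ∈ Set.range cellCharge ∪ {cellObs g}, ∀ b ∈ Set.range cellCharge ∪ {cellObs g}, ∀ t : ℝ,
      Integrable (fun x : V3 => cov[a, (b ∘ Φ.flow t) ∘ spatialShift x; G]) volume) :
    IsLocalObservableSpace Φ G (flowShiftSpan Φ (Set.range cellCharge ∪ {cellObs g})) := by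
  obtain ⟨hD, hS⟩ := hΦ z 1 hz one_pos G hG
  haveI : IsProbabilityMeasure G := hG.1
  have hflow : ∀ t : ℝ, MeasurePreserving (Φ.flow t) G G := fun t => hS.measurePreserving t
  have hshift : ∀ x : V3, MeasurePreserving (spatialShift x) G G := fun x =>
    ⟨Literature.Analysis.FunctionSpaces.PointConfig.measurable_translate _, hti x⟩
  have hzero : Φ.flow 0 =ᵐ[G] id := by
    filter_upwards [hD] with ω hω
    exact Φ.flow_zero ω hω
  have hadd : ∀ s t : ℝ, Φ.flow (s + t) =ᵐ[G] Φ.flow s ∘ Φ.flow t := fun s t => Φ.flow_add_ae hD hS s t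
  have hch : ∀ i : Fin 5, cellCharge i ∈ flowShiftSpan Φ (Set.range cellCharge ∪ {cellObs g}) :=
    fun i => subset_flowShiftSpan (Or.inl ⟨i, rfl⟩)
  have hL2 : ∀ f ∈ flowShiftSpan Φ (Set.range cellCharge ∪ {cellObs g}), MemLp f 2 G :=
    fun f hf => memLp_of_mem_flowShiftSpan Φ G hflow hshift hmom hf
  have hcov : ∀ f ∈ flowShiftSpan Φ (Set.range cellCharge ∪ {cellObs g}),
      ∀ f' ∈ flowShiftSpan Φ (Set.range cellCharge ∪ {cellObs g}),
        Integrable (fun x : V3 => cov[f, f' ∘ spatialShift x; G]) volume :=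
    fun f hf f' hf' => integrable_cov_of_mem_flowShiftSpan Φ G hflow hshift hzero hadd hcomm hmom hcl hf hf'
  refine (isLocalObservableSpace_flowShiftSpan_iff hch).2 ⟨fun f hf => hL2 f hf, fun f hf f' hf' => hcov f hf f' hf', ?_⟩
  intro f hf
  exact integral_cov_spatialShift_nonneg G hG.1 hshift f
    (measurable_of_mem_flowShiftSpan Φ (measurable_generators hg) hf) (hL2 f hf) (hcov f hf f hf)

/-- **Per-profile dynamical packaging at fixed parameters** (assembly): the datum
`F := Φ.fluctuationData ⟨G, flowShiftSpan Φ {n_i, A_g}, …⟩` has state `G` (definitionally), is carried by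
`Φ`, contains `A_g`, and — by `stub_strongContinuityOfGenerators` with dynamical continuity of the six
generators — has a strongly continuous Koopman group. [folklore] -/
theorem exists_packaging_min {z : ℝ} (hz : 0 < z) {Φ : InfiniteHardSphereFlow (Fin 3) 1}
    (hΦ : Φ.IsEquilibriumFlow) {G : Measure MarkedConfig} (hG : IsHardSphereGibbs 1 z 1 (0 : V3) G)
    (hti : IsTranslationInvariant G)
    (hcomm : ∀ (t : ℝ) (x : V3), Φ.flow t ∘ spatialShift x =ᵐ[G] spatialShift x ∘ Φ.flow t)
    {g : V3 → ℝ} (h𝒱 : IsLocalObservableSpace Φ G (flowShiftSpan Φ (Set.range cellCharge ∪ {cellObs g})))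
    (hSC : Registered.stub_strongContinuityOfGenerators)
    (hdc : ∀ b ∈ Set.range cellCharge ∪ {cellObs g},
      ContinuousAt (fun t : ℝ => ∫ x : V3, cov[b, (b ∘ Φ.flow t) ∘ spatialShift x; G]) 0) :
    ∃ F : HardSphereFluctuationData 1,
      F.μ = G ∧
      (∃ Φ : InfiniteHardSphereFlow (Fin 3) 1, Φ.IsEquilibriumFlow ∧ ∀ t : ℝ, F.flow t =ᵐ[F.μ] Φ.flow t) ∧
      (∀ ψ : HardSphereFluctuationSpace F, Continuous fun t : ℝ => F.koopman t ψ) ∧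
      cellObs g ∈ F.localObs := by
  let St : FluctuationStructure (volume : Measure V3) spatialShift :=
    { μ := G
      isProbabilityMeasure := hG.1
      measurePreserving_shift := fun x => ⟨Literature.Analysis.FunctionSpaces.PointConfig.measurable_translate _, hti x⟩
      localObs := flowShiftSpan Φ (Set.range cellCharge ∪ {cellObs g})
      memLp_of_mem := h𝒱.memLp
      comp_shift_mem := h𝒱.comp_shift_mem
      integrable_cov := h𝒱.integrable_cov
      form_self_nonneg := h𝒱.form_self_nonneg }
  have hP : Φ.IsAEDefined St.μ := hΦ.isAEDefined hz one_pos hG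
  have hS : Φ.IsStationary St.μ := hΦ.isStationary hz one_pos hG
  refine ⟨Φ.fluctuationData St hP hS hcomm h𝒱.comp_flow_mem h𝒱.cellCharge_mem, rfl,
    ⟨Φ, hΦ, fun t => Filter.EventuallyEq.rfl⟩, ?_, subset_flowShiftSpan (Or.inr rfl)⟩
  exact hSC 1 (Φ.fluctuationData St hP hS hcomm h𝒱.comp_flow_mem h𝒱.cellCharge_mem) Φ
    (Set.range cellCharge ∪ {cellObs g}) (fun t => rfl) rfl hdc

/-- **PER-PROFILE DYNAMICAL PACKAGING from the five framework stubs** (the v6 replacement of the v5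
stub `stub_fluctuationPackagingUnit`): below `σ₃ := min 1 (min z₃ z₄ / 2)`, every translation-invariant
DLR state `G` of unit hard spheres with `M_1` marks, activity `0 < z ≤ 2σ³` and density `σ³` is, for each
continuous polynomially bounded profile `g ⊥ 1`, the state of some `F : HardSphereFluctuationData 1`
carried by Alexander's flow, with strongly continuous Koopman group and `A_g ∈ 𝒱_F`
(`𝒱_F = flowShiftSpan Φ {n_i, A_g}`; Alexander's flow from `stub_alexanderFlow.1`, a.e. shift
commutation from `.2` by `equilibriumFlowShiftCovariant_of_unique`). [folklore] -/
theorem packaging_of (hAlex : Registered.stub_alexanderFlow) (hC : Registered.stub_staticClusteringCharges)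
    (hP : Registered.stub_staticClusteringProfile) (hD : Registered.stub_dynamicClusteringOneBody)
    (hSC : Registered.stub_strongContinuityOfGenerators) :
    ∃ σ₃ : ℝ, 0 < σ₃ ∧ ∀ σ : ℝ, 0 < σ → σ < σ₃ → ∀ z : ℝ, 0 < z → z ≤ 2 * σ ^ 3 →
      ∀ G : Measure MarkedConfig, IsHardSphereGibbs 1 z 1 (0 : V3) G → IsTranslationInvariant G →
        PointProcess.density G = ENNReal.ofReal (σ ^ 3) →
        ∀ g : V3 → ℝ, Continuous g → (∃ (C : ℝ) (k : ℕ), ∀ v, |g v| ≤ C * (1 + ‖v‖) ^ k) →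
          (∫ v, g v * localMaxwellian 1 1 (0 : V3) v = 0) →
          ∃ F : HardSphereFluctuationData 1,
            F.μ = G ∧
            (∃ Φ : InfiniteHardSphereFlow (Fin 3) 1, Φ.IsEquilibriumFlow ∧ ∀ t : ℝ, F.flow t =ᵐ[F.μ] Φ.flow t) ∧
            (∀ ψ : HardSphereFluctuationSpace F, Continuous fun t : ℝ => F.koopman t ψ) ∧
            cellObs g ∈ F.localObs := by
  obtain ⟨z₃, hz₃, Hst⟩ := staticClustering_generators hC hP
  obtain ⟨z₄, hz₄, Hdyn⟩ := hD
  obtain ⟨Φ, hΦ⟩ := hAlex.1 (zero_lt_one' ℝ)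
  have hm : 0 < min z₃ z₄ / 2 := half_pos (lt_min hz₃ hz₄)
  refine ⟨min 1 (min z₃ z₄ / 2), lt_min one_pos hm, ?_⟩
  intro σ hσ hσlt z hz hzle G hG hti _hρ g hg hb hg0
  have hσ1 : σ < 1 := lt_of_lt_of_le hσlt (min_le_left _ _)
  have hσm : σ < min z₃ z₄ / 2 := lt_of_lt_of_le hσlt (min_le_right _ _)
  have hσ3le : σ ^ 3 ≤ σ := by
    calc σ ^ 3 = σ * (σ * σ) := by ring
      _ ≤ σ * (1 * 1) := by gcongr
      _ = σ := by ring
  have hzlt : z < min z₃ z₄ := by linarith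
  have hz3 : z < z₃ := lt_of_lt_of_le hzlt (min_le_left _ _)
  have hz4 : z < z₄ := lt_of_lt_of_le hzlt (min_le_right _ _)
  -- a.e. shift commutation of the equilibrium flow (Alexander uniqueness)
  have hcomm : ∀ (t : ℝ) (x : V3), Φ.flow t ∘ spatialShift x =ᵐ[G] spatialShift x ∘ Φ.flow t :=
    fun t x => equilibriumFlowShiftCovariant_of_unique hAlex.2 1 one_pos Φ hΦ z 1 hz one_pos G hG t x
  -- static clustering of the six generators, then the dynamic upgrade + dynamical continuity
  have hst := Hst z hz hz3 G hG hti g hg hb hg0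
  obtain ⟨hcl, hdc⟩ := Hdyn Φ hΦ z hz hz4 G hG hti g hg hb hg0 hst
  have h𝒱 := isLocalObservableSpace_min hz hΦ hG hti hcomm hg (memLp_generators hz hG hg hb) hcl
  exact exists_packaging_min hz hΦ hG hti hcomm h𝒱 hSC hdc

/-- COMPOSITION (kernel-checked, axiom-clean, nothing admitted): the five framework stubs, the
identification stub and the route item `ChargesCompleteHS` (stmt-14141, at `σ = β = 1`) imply the crux
`MourreKoopmanCharges.OneBodyCompleteness` BY NAME, the torus side being supplied by the landed
`stub_torusMoments` / `stub_windowPassage` and the mean ergodic theorem, the static half by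
`stub_diluteGibbsStateUnit` (CLOSED). Proof: `z₀` from `ChargesCompleteHS 1 1`, `z₂` from the
identification, `σ₁` from the dilute state, `σ₃` from `packaging_of`, `σ₀ := min (min σ₁ σ₃) (min 2⁻¹
(min z₀ z₂ / 2))`; for `σ < σ₀`, `θ > 0`, `h` as in the crux put `h_θ := h(√θ ·)` (continuous, polynomially
bounded, `⊥ {1, v, |v|²}` in `L²(M_1)`); package the dilute state for the profile `h_θ`; the datum `F` has
complete charges, so `ψ = [A_{h_θ}] ⊥ 𝒬₀` and the Cesàro means of `⟪U_u ψ, ψ⟫`, hence of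
`c(s) = K⟪U_{κ s} ψ, ψ⟫` (`κ = √θ/σ > 0`), vanish; identification + torus moments give pointwise convergence
of the raw two-time moments `f_N(s) → (∫χ²) c(s)` with `|f_N(s)| ≤ f_N(0) ≤ M`; window passage and
`δ/2 + δ/2`. -/
theorem OneBodyCompleteness_of (hAlex : Registered.stub_alexanderFlow)
    (hD1 : Registered.stub_generatorsContinuousClustering)
    (hI1 : Registered.stub_twoTimeLocalLimitUnit) (hI2 : Registered.stub_uniformTorusTwoTimeClustering)
    (h3 : ChargesCompleteHS) :
    OneBodyCompleteness := by
  -- the landed static stubs (p162886, p163877, p164213), the landed strong-continuity stub (p164309), the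
  -- dynamic core from D1 and the landed D2 (p168987) by the landed reduction (p165274), and the identification
  -- from I1, I2 by the landed reduction (p169750/p169946)
  have hC : Registered.stub_staticClusteringCharges :=
    staticClusteringCharges_of stub_densityClustering stub_chargeClusteringOfDensity
  have hP : Registered.stub_staticClusteringProfile := stub_staticClusteringProfile
  have hSC : Registered.stub_strongContinuityOfGenerators := stub_strongContinuityOfGenerators
  have hD : Registered.stub_dynamicClusteringOneBody :=
    Summit.AtomisticToContinuum.HydrodynamicLimit.Theorems.MourreKoopmanChargesOneBodyCompleteness.dynamicClusteringOneBody_of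
      hD1 stub_flowMeanSquareContinuity
  have h2 : Registered.stub_torusIdentificationUnit :=
    Summit.AtomisticToContinuum.HydrodynamicLimit.Theorems.MourreKoopmanChargesOneBodyCompleteness.torusIdentificationUnit_of_conjectures
      hI1 hI2
  obtain ⟨z₀, hz₀, hcomplete⟩ := h3 1 one_pos 1 one_pos
  obtain ⟨z₂, hz₂, hident⟩ := h2
  obtain ⟨σ₁, hσ₁, hstate⟩ := stub_diluteGibbsStateUnit
  obtain ⟨σ₃, hσ₃, hpack⟩ := packaging_of hAlex hC hP hD hSC
  have hm : 0 < min z₀ z₂ / 2 := half_pos (lt_min hz₀ hz₂)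
  refine ⟨min (min σ₁ σ₃) (min (1 / 2) (min z₀ z₂ / 2)),
    lt_min (lt_min hσ₁ hσ₃) (lt_min one_half_pos hm), ?_⟩
  intro σ hσ hσlt θ hθ h hh hbound hm0 hm1 hm2 Φ χ hχ δ hδ
  have hσ1 : σ < σ₁ := lt_of_lt_of_le hσlt ((min_le_left _ _).trans (min_le_left _ _))
  have hσ3 : σ < σ₃ := lt_of_lt_of_le hσlt ((min_le_left _ _).trans (min_le_right _ _))
  have hσhalf : σ < 1 / 2 := lt_of_lt_of_le hσlt ((min_le_right _ _).trans (min_le_left _ _))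
  have hσm : σ < min z₀ z₂ / 2 := lt_of_lt_of_le hσlt ((min_le_right _ _).trans (min_le_right _ _))
  -- the dilute Gibbs state of density σ³
  obtain ⟨z, G, hz, hzle, hGibbsG, hti, hρ⟩ := hstate σ hσ hσ1
  -- the rescaled profile h_θ = h (√θ ·)
  have hhθ : Continuous fun w : V3 => h (Real.sqrt θ • w) := hh.comp (continuous_const_smul (Real.sqrt θ))
  have hboundθ := poly_bound_comp_sqrt (θ := θ) hbound
  obtain ⟨hm0', hm1', hm2'⟩ := orthogonal_comp_sqrt hθ hm0 hm1 hm2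
  -- its dynamical packaging
  obtain ⟨F, hFμ, hflow, hcont, hmem⟩ :=
    hpack σ hσ hσ3 z hz hzle G hGibbsG hti hρ (fun w => h (Real.sqrt θ • w)) hhθ hboundθ hm0'
  have hGibbs : IsHardSphereGibbs 1 z 1 (0 : V3) F.μ := by rw [hFμ]; exact hGibbsG
  -- activity below both thresholds: z ≤ 2σ³ ≤ 2σ < min z₀ z₂
  have hσ3le : σ ^ 3 ≤ σ := by
    calc σ ^ 3 = σ * (σ * σ) := by ring
      _ ≤ σ * (1 * 1) := by gcongr <;> linarith
      _ = σ := by ring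
  have hzlt : z < min z₀ z₂ := by linarith
  have hz0 : z < z₀ := lt_of_lt_of_le hzlt (min_le_left _ _)
  have hz2 : z < z₂ := lt_of_lt_of_le hzlt (min_le_right _ _)
  -- density one-body charge: ∫ n = σ³ (hard core a.e. from the a.e.-defined Alexander flow)
  have hcore : ∀ᵐ ω ∂F.μ, IsHardCore 1 ω := by
    obtain ⟨Ψ, hΨ, -⟩ := hflow
    exact Ψ.isHardCore_ae (hΨ z 1 hz one_pos F.μ hGibbs).1
  have hdens : ∫ ω, cellCharge 0 ω ∂F.μ = σ ^ 3 := by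
    rw [integral_cellCharge_zero_eq_toReal_density one_pos hcore, hFμ, hρ, ENNReal.toReal_ofReal (by positivity)]
  -- Maxwellian orthogonality in ℋ_F from the DLR computation (landed `gibbsMaxwellianOrthogonality`)
  have hGibbs' : IsHardSphereGibbs 1 z (1 : ℝ)⁻¹ (0 : V3) F.μ := by rw [inv_one]; exact hGibbs
  have horth' : ∀ i : Fin 5, ⟪F.fluct (cellObs fun w => h (Real.sqrt θ • w)), F.chargeClass i⟫_ℝ = 0 := by
    intro i
    rw [HardSphereFluctuationData.chargeClass_def, FluctuationStructure.inner_fluct_fluct hmem (F.cellCharge_mem i),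
      FluctuationStructure.form_def]
    simp only [gibbsMaxwellianOrthogonality 1 z 1 one_pos hz one_pos F.μ hGibbs' _ hhθ hboundθ hm0' hm1' hm2' i,
      integral_zero]
  -- charges are complete for the framework data (route item ChargesCompleteHS at σ = β = 1)
  have hcc : F.ChargesComplete := hcomplete z hz hz0 F hGibbs hflow
  -- ψ = [A_{h_θ}] is orthogonal to the conserved space 𝒬₀ ⊆ 𝒞 = span (q_i)
  set ψ := F.fluct (cellObs fun w => h (Real.sqrt θ • w)) with hψdef
  have hperp : ∀ φ ∈ F.conservedSpace, ⟪ψ, φ⟫_ℝ = 0 := by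
    intro φ hφ
    have hφ' : φ ∈ Submodule.span ℝ (Set.range F.chargeClass) := hcc hφ
    obtain ⟨a, rfl⟩ := (Submodule.mem_span_range_iff_exists_fun ℝ).1 hφ'
    rw [inner_sum]
    refine Finset.sum_eq_zero fun i _ => ?_
    rw [real_inner_smul_right, horth' i, mul_zero]
  -- mean ergodic theorem: Cesàro decay of ⟪U_u ψ, ψ⟫, then of the time-rescaled version
  have hκ : 0 < Real.sqrt θ / σ := div_pos (Real.sqrt_pos.2 hθ) hσ
  have hME := meanErgodic 1 F hcont ψ hperp
  have hMEκ := tendsto_cesaro_comp_mul (φ := fun u => ⟪F.koopman u ψ, ψ⟫_ℝ) hκ hME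
  -- identification constant and pointwise convergence of (N+1)·cov
  obtain ⟨K, hK⟩ := hident σ hσ hσhalf z hz hz2 θ hθ F hGibbs hflow hdens h hh hbound hmem hm0 hm1 hm2
  have hcov := fun s : ℝ => hK Φ χ hχ s
  -- continuity of the limit profile g(s) = (∫χ²) K ⟪U_{κ s} ψ, ψ⟫
  have hgc : Continuous fun s : ℝ => (∫ x, χ x * χ x) * K * ⟪F.koopman (Real.sqrt θ / σ * s) ψ, ψ⟫_ℝ :=
    continuous_const.mul (((hcont ψ).comp (continuous_const.mul continuous_id)).inner continuous_const)
  -- torus moments: cov = raw two-time moment, and domination by the equal-time moment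
  have hmom := fun (N : ℕ) (t : ℝ) => stub_torusMoments σ hσ hσhalf θ hθ h hh hbound hm0 N (Φ N) χ hχ t
  -- pointwise convergence of the raw moments
  have hraw : ∀ s : ℝ, Tendsto (fun N : ℕ => ((N : ℝ) + 1) *
      ∫ z, (∫ y, χ y.1 * h y.2 ∂(empiricalMeasure ((Φ N).flow (s * ((N : ℝ) + 1) ^ (-(1 / 3 : ℝ))) z))) *
        (∫ y, χ y.1 * h y.2 ∂(empiricalMeasure z))
        ∂(localGibbsLaw σ (fun _ => 1) (fun _ => 0) (fun _ => θ) N (Φ N))) atTop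
      (𝓝 ((∫ x, χ x * χ x) * K * ⟪F.koopman (Real.sqrt θ / σ * s) ψ, ψ⟫_ℝ)) := by
    intro s
    refine (hcov s).congr fun N => ?_
    rw [(hmom N (s * ((N : ℝ) + 1) ^ (-(1 / 3 : ℝ)))).1]
  -- the equal-time moments converge, hence are bounded
  have hraw0 : Tendsto (fun N : ℕ => ((N : ℝ) + 1) *
      ∫ z, (∫ y, χ y.1 * h y.2 ∂(empiricalMeasure ((Φ N).flow 0 z))) * (∫ y, χ y.1 * h y.2 ∂(empiricalMeasure z))
        ∂(localGibbsLaw σ (fun _ => 1) (fun _ => 0) (fun _ => θ) N (Φ N))) atTop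
      (𝓝 ((∫ x, χ x * χ x) * K * ⟪F.koopman (Real.sqrt θ / σ * 0) ψ, ψ⟫_ℝ)) := by
    have h0 := hraw 0
    simp only [zero_mul, mul_zero] at h0 ⊢
    exact h0
  obtain ⟨M, hM⟩ := exists_forall_le_of_tendsto hraw0
  -- uniform domination of the raw moments
  have hbd : ∀ (N : ℕ) (s : ℝ), |((N : ℝ) + 1) *
      ∫ z, (∫ y, χ y.1 * h y.2 ∂(empiricalMeasure ((Φ N).flow (s * ((N : ℝ) + 1) ^ (-(1 / 3 : ℝ))) z))) *
        (∫ y, χ y.1 * h y.2 ∂(empiricalMeasure z))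
        ∂(localGibbsLaw σ (fun _ => 1) (fun _ => 0) (fun _ => θ) N (Φ N))| ≤ M := by
    intro N s
    have hN : (0 : ℝ) ≤ (N : ℝ) + 1 := by positivity
    have hdom := (hmom N (s * ((N : ℝ) + 1) ^ (-(1 / 3 : ℝ)))).2
    rw [abs_mul, abs_of_nonneg hN]
    exact (mul_le_mul_of_nonneg_left hdom hN).trans (hM N)
  -- the limiting window averages tend to zero (mean ergodic theorem, rescaled time)
  have hL : Tendsto (fun S : ℝ => S⁻¹ * ∫ s in (0 : ℝ)..S, (∫ x, χ x * χ x) * K *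
      ⟪F.koopman (Real.sqrt θ / σ * s) ψ, ψ⟫_ℝ) atTop (𝓝 0) := by
    have e : (fun S : ℝ => S⁻¹ * ∫ s in (0 : ℝ)..S, (∫ x, χ x * χ x) * K *
        ⟪F.koopman (Real.sqrt θ / σ * s) ψ, ψ⟫_ℝ) =
        fun S : ℝ => (∫ x, χ x * χ x) * K * (S⁻¹ * ∫ s in (0 : ℝ)..S, ⟪F.koopman (Real.sqrt θ / σ * s) ψ, ψ⟫_ℝ) := by
      funext S
      rw [intervalIntegral.integral_const_mul]
      ring
    rw [e]
    simpa using hMEκ.const_mul ((∫ x, χ x * χ x) * K)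
  -- choose the window threshold S₀
  obtain ⟨S₁, hS₁⟩ := Metric.tendsto_atTop.1 hL (δ / 2) (half_pos hδ)
  refine ⟨max S₁ 1, lt_of_lt_of_le one_pos (le_max_right _ _), ?_⟩
  intro S hS
  have hSpos : 0 < S := lt_of_lt_of_le one_pos ((le_max_right _ _).trans hS)
  have hLS := hS₁ S ((le_max_left _ _).trans hS)
  rw [Real.dist_eq, sub_zero] at hLS
  -- window passage on the torus: eventually in N
  have hW := stub_windowPassage (fun (N : ℕ) (s : ℝ) => ((N : ℝ) + 1) *
      ∫ z, (∫ y, χ y.1 * h y.2 ∂(empiricalMeasure ((Φ N).flow (s * ((N : ℝ) + 1) ^ (-(1 / 3 : ℝ))) z))) *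
        (∫ y, χ y.1 * h y.2 ∂(empiricalMeasure z))
        ∂(localGibbsLaw σ (fun _ => 1) (fun _ => 0) (fun _ => θ) N (Φ N)))
    (fun s : ℝ => (∫ x, χ x * χ x) * K * ⟪F.koopman (Real.sqrt θ / σ * s) ψ, ψ⟫_ℝ)
    M hgc hbd hraw S hSpos (δ / 2) (half_pos hδ)
  obtain ⟨N₀, hN₀⟩ := eventually_atTop.1 hW
  refine ⟨N₀, fun N hN => ?_⟩
  have hNS := hN₀ N hN
  linarith [hNS, hLS]

/-- Wiring check: the registered stubs and the route item `ChargesCompleteHS` feed `OneBodyCompleteness_of`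
as stated (once the six stubs are proved, the line IS a proof of `ChargesCompleteHS → OneBodyCompleteness`,
and with crux #3 stmt-14141 a proof of the crux `MourreKoopmanCharges.OneBodyCompleteness`). -/
example (hCC : ChargesCompleteHS) : OneBodyCompleteness :=
  OneBodyCompleteness_of stub_alexanderFlow stub_generatorsContinuousClustering stub_twoTimeLocalLimitUnit
    stub_uniformTorusTwoTimeClustering hCC

end Summit.AtomisticToContinuum.HydrodynamicLimit.Cruxes.OneBodyCompleteness.Birth
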